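import Literature.NumberTheory.Automorphic.CMBorelHaarTorusUnipotent
import Literature.NumberTheory.Automorphic.VanDijkTraceParabolicIndGLProof
import HarnessLib

/-!
# van Dijk's kernel formula for `i_G(χ)` on `U(Φ₃)(L⁺_v)` in `K · T · N` coordinates: `tr i_G(χ)(f) = ∫_K C ∫_T ∫_N f(k⁻¹ t n k) χ(t) δ_B^{1∕2}(t) dn dt dk`
# (van Dijk 1972, Thm. p. 237; Bernstein–Zelevinsky 1977 §2.3; Rogawski 1990 §4.9, §12.2)

Topic `NumberTheory/Automorphic`; namespace `Literature.NumberTheory.Automorphic.UnitaryGroup`.  THEOREMS ONLY (no definition, no instance, no notation, no named fact,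
no `sorry`).  Cell `pub/hodgecm-mathlib`, line «CMCharIdentityTest» (F0P3b), PLAN v14 §9 joint (vdG)∕(vdH) of (N-492) `stub_inducedCharTransfer` [Rogawski1990 Lemma 4.9.2]:
★ `UnitaryGroup.exists_smoothTrace_cmPrincipalSeries_eq_integral_KB` (the `K · B` kernel formula, p841747) with its inner `∫_B` unfolded along `B = T ⋉ N` by ★
`exists_haar_cmBorel_integral_eq_torus_unipotent` and ★ `apply_proj_mul_rootDeltaChar_torus_mul_unipotent` (p841822).
* **`exists_smoothTrace_cmPrincipalSeries_three_eq_integral_KTN`** — for a character `χ` of the diagonal torus `T` of `G = U(Φ₃)(L⁺_v)` with `t ↦ χ(t)` continuous, a compact open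
  subgroup `K` with `G = B · K`, and Haar measures `ν` on `G`, `μ_T` on `T`, `μ_N` on `N`, `μ_K` on `K`: there is `C > 0`, CALIBRATED by
  `∫_G F dν = C ∫_K ∫_T ∫_N F(t n k) dμ_N dμ_T dμ_K` (continuous compactly supported `F`), with
  `(cmPrincipalSeries L 3 v χ).smoothTrace ν f = ∫_K C · ∫_T ∫_N f(k⁻¹ (t n) k) · χ(t) δ_B^{1∕2}(t) dμ_N dμ_T dμ_K` for every locally constant compactly supported `f`.
  [What (vdG) still needs after this: the orbital form `∫_N f(k⁻¹ t n k) dn = ‖D(t)‖^{-1∕2} ∫_N f(k⁻¹ n⁻¹ t n k) dn` for regular `t` — B-p12's Weyl-numerator currency.]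
HONEST LABEL: HC_CM is proved only modulo the printed citations (2 remaining named inputs hLiu418, h413) until rung 0 closes; this file pays no letter by itself.

## References
* [vanDijk1972] G. van Dijk, *Computation of certain induced characters of 𝔭-adic groups*, Math. Ann. 199 (1972), 229–240, Thm. p. 237.
* [BernsteinZelevinsky1977] I. N. Bernstein, A. V. Zelevinsky, *Induced representations of reductive 𝔭-adic groups I*, §2.3.
* [Rogawski1990] J. D. Rogawski, *Automorphic Representations of Unitary Groups in Three Variables* (1990), §4.9 p. 56, §12.2 p. 173.
-/

set_option autoImplicit false

noncomputable section

open NumberField IsDedekindDomain MeasureTheory MeasureTheory.Measure Topology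
open scoped MatrixGroups

namespace Literature.NumberTheory.Automorphic

namespace UnitaryGroup

variable (L : Type) [Field L] [NumberField L] [IsCMField L] (v : HeightOneSpectrum (𝓞 ↥(maximalRealSubfield L)))
  [MeasurableSpace ↥(unitaryGroupOfForm (conjLocal L (IsCMField.complexConj L) v) (cmLocalForm L 3 v))]
  [BorelSpace ↥(unitaryGroupOfForm (conjLocal L (IsCMField.complexConj L) v) (cmLocalForm L 3 v))]

set_option maxHeartbeats 1600000 in
set_option synthInstance.maxHeartbeats 400000 in
/-- **van Dijk's kernel formula for `i_G(χ)` on `U(Φ₃)(L⁺_v)` in `K · T · N` coordinates**: for a character `χ` of the diagonal torus with `t ↦ χ(t)` continuous, a compact open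
subgroup `K` with `G = B · K` (e.g. `K = K_v`: ★ `isCompact_isOpen_cmLocalIntegralLevel`, ★ `exists_borel_mul_mem_cmLocalIntegralLevel`) and Haar measures `ν`, `μ_T`, `μ_N`, `μ_K`, there
is `C > 0`, calibrated by `∫_G F dν = C ∫_K ∫_T ∫_N F(t n k)`, with
`(cmPrincipalSeries L 3 v χ).smoothTrace ν f = ∫_K C · ∫_T ∫_N f(k⁻¹ (t n) k) · χ(t) δ_B^{1∕2}(t) dμ_N dμ_T dμ_K` for every locally constant compactly supported `f`.
[cite: vanDijk1972, Thm. p. 237] [cite: BernsteinZelevinsky1977, §2.3] [cite: Rogawski1990, §4.9 p. 56, §12.2 p. 173] -/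
theorem exists_smoothTrace_cmPrincipalSeries_three_eq_integral_KTN
    (χ : ↥(torusU (conjLocal L (IsCMField.complexConj L) v) (cmLocalForm L 3 v)) →* ℂˣ) (hχ : Continuous fun t => ((χ t : ℂˣ) : ℂ))
    (KU : Subgroup ↥(unitaryGroupOfForm (conjLocal L (IsCMField.complexConj L) v) (cmLocalForm L 3 v)))
    (hKUo : IsOpen (KU : Set ↥(unitaryGroupOfForm (conjLocal L (IsCMField.complexConj L) v) (cmLocalForm L 3 v))))
    (hKUc : IsCompact (KU : Set ↥(unitaryGroupOfForm (conjLocal L (IsCMField.complexConj L) v) (cmLocalForm L 3 v))))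
    (hGK : ∀ g : ↥(unitaryGroupOfForm (conjLocal L (IsCMField.complexConj L) v) (cmLocalForm L 3 v)),
      ∃ h : ↥(cmBorelTriple L 3 v).P, ∃ κ ∈ KU, g = h * κ)
    (ν : Measure ↥(unitaryGroupOfForm (conjLocal L (IsCMField.complexConj L) v) (cmLocalForm L 3 v))) [ν.IsHaarMeasure]
    (μT : Measure ↥(cmBorelTriple L 3 v).M) [μT.IsHaarMeasure] (μN : Measure ↥(cmBorelTriple L 3 v).N) [μN.IsHaarMeasure]
    (μK : Measure ↥KU) [μK.IsHaarMeasure] :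
    haveI := locallyCompactSpace_cmBorelU L 3 v
    ∃ C : ℝ, 0 < C ∧
      (∀ F : ↥(unitaryGroupOfForm (conjLocal L (IsCMField.complexConj L) v) (cmLocalForm L 3 v)) → ℂ, Continuous F → HasCompactSupport F →
        ∫ g, F g ∂ν = C * ∫ k : ↥KU, ∫ t : ↥(cmBorelTriple L 3 v).M, ∫ n : ↥(cmBorelTriple L 3 v).N,
          F ((t : ↥(unitaryGroupOfForm (conjLocal L (IsCMField.complexConj L) v) (cmLocalForm L 3 v))) * n * k) ∂μN ∂μT ∂μK) ∧
      ∀ f : ↥(unitaryGroupOfForm (conjLocal L (IsCMField.complexConj L) v) (cmLocalForm L 3 v)) → ℂ, IsLocallyConstant f → HasCompactSupport f →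
        (cmPrincipalSeries L 3 v χ).smoothTrace ν f =
          ∫ k : ↥KU, (C : ℂ) * ∫ t : ↥(cmBorelTriple L 3 v).M, ∫ n : ↥(cmBorelTriple L 3 v).N,
            f ((k : ↥(unitaryGroupOfForm (conjLocal L (IsCMField.complexConj L) v) (cmLocalForm L 3 v)))⁻¹ *
                ((t : ↥(unitaryGroupOfForm (conjLocal L (IsCMField.complexConj L) v) (cmLocalForm L 3 v))) * n) * k) *
              (((χ t : ℂˣ) : ℂ) *
                ((rootDeltaChar (cmBorelTriple L 3 v).P
                  ⟨(t : ↥(unitaryGroupOfForm (conjLocal L (IsCMField.complexConj L) v) (cmLocalForm L 3 v))), (cmBorelTriple L 3 v).M_le t.2⟩ : ℂˣ) : ℂ))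
            ∂μN ∂μT ∂μK := by
  haveI := locallyCompactSpace_cmBorelU L 3 v
  haveI : T1Space (LocalRing L v) := inferInstance
  have hBcl : IsClosed ((cmBorelTriple L 3 v).P : Set ↥(unitaryGroupOfForm (conjLocal L (IsCMField.complexConj L) v) (cmLocalForm L 3 v))) :=
    isClosed_borelU (conjLocal L (IsCMField.complexConj L) v) (cmLocalForm L 3 v)
  have hemb : IsClosedEmbedding ((↑) : ↥(cmBorelTriple L 3 v).P → ↥(unitaryGroupOfForm (conjLocal L (IsCMField.complexConj L) v) (cmLocalForm L 3 v))) :=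
    hBcl.isClosedEmbedding_subtypeVal
  obtain ⟨μB, hμB, hTN⟩ := exists_haar_cmBorel_integral_eq_torus_unipotent L v μT μN
  haveI := hμB
  obtain ⟨C, hC, hcal, htr⟩ := exists_smoothTrace_cmPrincipalSeries_eq_integral_KB L 3 v χ KU hKUo hKUc hGK ν μB μK
  have hδc : Continuous fun b : ↥(cmBorelTriple L 3 v).P => ((rootDeltaChar (cmBorelTriple L 3 v).P b : ℂˣ) : ℂ) :=
    continuous_rootDeltaChar_unitsCoe' _
  have hχc : Continuous fun b : ↥(cmBorelTriple L 3 v).P => ((χ ((cmBorelTriple L 3 v).proj b) : ℂˣ) : ℂ) :=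
    continuous_apply_proj_borelTriple (conjLocal L (IsCMField.complexConj L) v) (cmLocalForm L 3 v) (cmLocalForm_eq_over L 3 v) χ hχ
  refine ⟨C, hC, fun F hF hFs => ?_, fun f hflc hfcs => ?_⟩
  · rw [hcal F hF hFs]
    congr 1
    refine integral_congr_ae (Filter.Eventually.of_forall fun k => ?_)
    have hc1 : Continuous fun b : ↥(cmBorelTriple L 3 v).P =>
        F ((b : ↥(unitaryGroupOfForm (conjLocal L (IsCMField.complexConj L) v) (cmLocalForm L 3 v))) * k) :=
      hF.comp (continuous_subtype_val.mul continuous_const)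
    have hs1 : HasCompactSupport fun b : ↥(cmBorelTriple L 3 v).P =>
        F ((b : ↥(unitaryGroupOfForm (conjLocal L (IsCMField.complexConj L) v) (cmLocalForm L 3 v))) * k) :=
      (hFs.comp_homeomorph (Homeomorph.mulRight
        (k : ↥(unitaryGroupOfForm (conjLocal L (IsCMField.complexConj L) v) (cmLocalForm L 3 v))))).comp_isClosedEmbedding hemb
    simp only
    rw [hTN _ hc1 hs1]
  · rw [htr f hflc hfcs]
    refine integral_congr_ae (Filter.Eventually.of_forall fun k => ?_)
    have hc2 : Continuous fun b : ↥(cmBorelTriple L 3 v).P =>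
        f ((k : ↥(unitaryGroupOfForm (conjLocal L (IsCMField.complexConj L) v) (cmLocalForm L 3 v)))⁻¹ * b * k) *
          (((χ ((cmBorelTriple L 3 v).proj b) : ℂˣ) : ℂ) * ((rootDeltaChar (cmBorelTriple L 3 v).P b : ℂˣ) : ℂ)) :=
      (hflc.continuous.comp ((continuous_const.mul continuous_subtype_val).mul continuous_const)).mul (hχc.mul hδc)
    have hs2' : HasCompactSupport fun b : ↥(cmBorelTriple L 3 v).P =>
        f ((k : ↥(unitaryGroupOfForm (conjLocal L (IsCMField.complexConj L) v) (cmLocalForm L 3 v)))⁻¹ * b * k) :=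
      (hfcs.comp_homeomorph
        ((Homeomorph.mulLeft (k : ↥(unitaryGroupOfForm (conjLocal L (IsCMField.complexConj L) v) (cmLocalForm L 3 v)))⁻¹).trans
          (Homeomorph.mulRight (k : ↥(unitaryGroupOfForm (conjLocal L (IsCMField.complexConj L) v) (cmLocalForm L 3 v)))))).comp_isClosedEmbedding
        hemb
    have hs2 : HasCompactSupport fun b : ↥(cmBorelTriple L 3 v).P =>
        f ((k : ↥(unitaryGroupOfForm (conjLocal L (IsCMField.complexConj L) v) (cmLocalForm L 3 v)))⁻¹ * b * k) *
          (((χ ((cmBorelTriple L 3 v).proj b) : ℂˣ) : ℂ) * ((rootDeltaChar (cmBorelTriple L 3 v).P b : ℂˣ) : ℂ)) :=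
      hs2'.mul_right
        (f' := fun b : ↥(cmBorelTriple L 3 v).P =>
          ((χ ((cmBorelTriple L 3 v).proj b) : ℂˣ) : ℂ) * ((rootDeltaChar (cmBorelTriple L 3 v).P b : ℂˣ) : ℂ))
    simp only
    congr 1
    rw [hTN _ hc2 hs2]
    refine integral_congr_ae (Filter.Eventually.of_forall fun t => integral_congr_ae (Filter.Eventually.of_forall fun n => ?_))
    simp only
    rw [← Units.val_mul, ← Units.val_mul, apply_proj_mul_rootDeltaChar_torus_mul_unipotent L 3 v χ t n]

end UnitaryGroup

end Literature.NumberTheory.Automorphic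

end
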